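import Mathlib
import HarnessLib
import Summits.PneNP.PneNP.Theses.CnfIdealGenLength
import Summits.PneNP.PneNP.Theorems.CnfIdealGenLengthFregeShortensGenLengthRule
import Literature.Computability.Complexity.ArthurMerlinKarpClosure
import Literature.Computability.Complexity.ProofComplexityProofs

/-!
# `FregeShortensGenLength` (stmt-PneNP-18886) — Part D: unrolling along the proof; the theorem

* `linesRepr`: along an `F`-derivation (sound `F`, lines of size `≤ s`) every LEFT combination
  `∑_{j<k} c_j tr(π_j)` (`wordDeg c_j ≤ D`) is a sum of `≤ k · K s²` single terms of cofactor degree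
  `≤ D + (k+1) K s`, INDEPENDENTLY of the coefficients: a unipotent left-linear system over `R⟨x⟩` — dag-like
  reuse of lines is free because cofactors are coefficient-blind;
* `proofRepr`: an `F`-proof of `T` of size `≤ s` gives `tr T` with `≤ K s³` terms of degree `≤ K s² + K s`;
* `cnfIdealGenLength_fregeShortensGenLength_proof : FregeShortensGenLength` — with `T_n := ¬ ofCNF (φ n)`
  (a tautology of size `≤ 5 p(n) + 2`, `tr T_n = clauseProduct ℚ (φ n)` on the nose) and `F.IsPolyBounded`,
  `s ≤ P(n)` for a polynomial `P`, and a polynomial is `≤ n^c` for `n ≥ 2` (`exists_pow_bound`).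
Only the SOUNDNESS half of `IsFrege F` is used; no non-commutative formula syntax and no simulation theorem
(LTW Thm 1.4) is needed — the Frege proof is simulated directly in `ℚ⟨x⟩` modulo the Boolean/commutator axioms.
-/

set_option linter.dupNamespace false -- `Summit.PneNP.PneNP.…`: summit = sub-problem name (D-0017)

/-! ## Part D — along the proof: a unipotent left-linear system, and the theorem -/

namespace Summit.PneNP.PneNP.Theorems.CnfIdealGenLength

open Filter
open Literature.Computability.Complexity
open Literature.Computability.MetaComplexity
open Literature.Computability.MetaComplexity.NCIPS

noncomputable section

variable {R : Type*} [CommRing R]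

/-- A metavariable occurring in `B` is replaced by a subformula of `B[σ]`, so `size (σ i) ≤ size (B[σ])`.
[folklore] -/
theorem size_le_size_subst (σ : ℕ → PropForm ℕ) (B : PropForm ℕ) {i : ℕ} (hi : i ∈ B.vars) :
    (σ i).size ≤ (B.subst σ).size := by
  induction B with
  | var j =>
    simp only [PropForm.vars, Finset.mem_singleton] at hi
    subst hi
    simp [PropForm.subst]
  | const b => simp [PropForm.vars] at hi
  | neg B ih =>
    simp only [PropForm.vars] at hi
    simp only [PropForm.subst, PropForm.size]
    exact (ih hi).trans (Nat.le_succ _)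
  | conj B C ihB ihC =>
    simp only [PropForm.vars, Finset.mem_union] at hi
    simp only [PropForm.subst, PropForm.size]
    rcases hi with hi | hi
    · exact (ihB hi).trans (by omega)
    · exact (ihC hi).trans (by omega)
  | disj B C ihB ihC =>
    simp only [PropForm.vars, Finset.mem_union] at hi
    simp only [PropForm.subst, PropForm.size]
    rcases hi with hi | hi
    · exact (ihB hi).trans (by omega)
    · exact (ihC hi).trans (by omega)

/-- The rule step uniformly over a finite list of sound rules (one constant `K` for all of them).
[folklore] -/
theorem rulesStep_list (l : List FregeRule) (hl : ∀ r ∈ l, r.IsSound) : ∃ K : ℕ, ∀ r ∈ l, ∀ K', K ≤ K' →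
    ∀ (n s k : ℕ) (σ : ℕ → PropForm ℕ) (t : ℕ → MonoidAlgebra R (FreeMonoid (Fin n))),
      (∀ i ∈ r.conclusion.vars ∪ r.premises.toFinset.biUnion PropForm.vars, (σ i).size ≤ s) →
      (∀ p ∈ r.premises, ∃ j < k, t j = trForm (stdLeaf R n) (p.subst σ)) →
      ∃ a : ℕ → MonoidAlgebra R (FreeMonoid (Fin n)), (∀ j, wordDeg (a j) ≤ K' * s) ∧
        Repr R (K' * s) (K' * s ^ 2)
          (trForm (stdLeaf R n) (r.conclusion.subst σ) - ∑ j ∈ Finset.range k, a j * t j) := by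
  induction l with
  | nil => exact ⟨0, fun r hr => by simp at hr⟩
  | cons r l ih =>
    obtain ⟨K₁, h₁⟩ := ruleStep (R := R) r (hl r (by simp))
    obtain ⟨K₂, h₂⟩ := ih fun r' hr' => hl r' (by simp [hr'])
    refine ⟨K₁ + K₂, fun r' hr' K' hK' => ?_⟩
    rcases List.mem_cons.1 hr' with rfl | hr'
    · exact h₁ K' (by omega)
    · exact h₂ r' hr' K' (by omega)

/-- **Left-linear unrolling along a derivation.** For a sound rule list `F` there is `K` such that for
every `F`-derivation `π` from no hypotheses with all lines of size `≤ s`, every LEFT combination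
`∑_{j<k} c_j · tr(π_j)` of its first `k` lines with `wordDeg c_j ≤ D` is a sum of at most `k · K s²`
single terms of cofactor degree `≤ D + (k+1) K s` — independently of the coefficients `c_j`: the
representation of line `k` modulo earlier lines (rule step) is substituted with its left coefficients
absorbed into the `c_j`, so dag-like reuse of lines costs nothing. [folklore] -/
theorem linesRepr (F : FregeSystem) (hF : F.IsSound) : ∃ K : ℕ, ∀ (n : ℕ) (π : List (PropForm ℕ)) (s : ℕ),
    F.IsDerivation ∅ π → (∀ θ ∈ π, θ.size ≤ s) → ∀ k, k ≤ π.length →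
      ∀ (D : ℕ) (c : ℕ → MonoidAlgebra R (FreeMonoid (Fin n))), (∀ j < k, wordDeg (c j) ≤ D) →
        Repr R (D + k * (K * s) + K * s) (k * (K * s ^ 2))
          (∑ j ∈ Finset.range k, c j * trForm (stdLeaf R n) (π.getD j (PropForm.const true))) := by
  obtain ⟨K, hK⟩ := rulesStep_list (R := R) F.rules hF
  refine ⟨K, fun n π s hπ hs k => ?_⟩
  induction k with
  | zero =>
    intro _ D c _
    simp only [Finset.range_zero, Finset.sum_empty]
    exact Repr.zero
  | succ k ih =>
    intro hk D c hc
    have hk' : k < π.length := hk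
    rcases hπ k hk' with hmem | hinf
    · simp only [Set.mem_empty_iff_false] at hmem
    obtain ⟨r, hr, σ, hconcl, hprem⟩ := hinf
    -- premises occur among the earlier lines
    have ht : ∀ p ∈ r.premises, ∃ j < k,
        trForm (stdLeaf R n) (π.getD j (PropForm.const true)) = trForm (stdLeaf R n) (p.subst σ) := by
      intro p hp
      obtain ⟨j, hj, hje⟩ := List.mem_iff_getElem.1 (hprem p hp)
      rw [List.length_take] at hj
      refine ⟨j, lt_of_lt_of_le hj (min_le_left _ _), ?_⟩
      rw [List.getD_eq_getElem _ _ (lt_of_lt_of_le hj (min_le_right _ _)), ← hje, List.getElem_take]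
    -- metavariables receive formulas of size ≤ s
    have hσ : ∀ i ∈ r.conclusion.vars ∪ r.premises.toFinset.biUnion PropForm.vars, (σ i).size ≤ s := by
      intro i hi
      rcases Finset.mem_union.1 hi with hi | hi
      · refine (size_le_size_subst σ r.conclusion hi).trans ?_
        rw [hconcl]
        exact hs _ (List.getElem_mem hk')
      · obtain ⟨p, hp, hip⟩ := Finset.mem_biUnion.1 hi
        refine (size_le_size_subst σ p hip).trans (hs _ (List.mem_of_mem_take (hprem p ?_)))
        exact List.mem_toFinset.1 hp
    obtain ⟨a, ha, hrepr⟩ := hK r hr K le_rfl n s k σ _ hσ ht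
    rw [hconcl] at hrepr
    have hline : trForm (stdLeaf R n) (π.getD k (PropForm.const true)) = trForm (stdLeaf R n) π[k] := by
      rw [List.getD_eq_getElem _ _ hk']
    -- absorb the left coefficients of line k into those of the earlier lines
    have ih' := ih hk'.le (D + K * s) (fun j => c j + c k * a j) fun j hj =>
      wordDeg_add_le_of_le ((hc j (by omega)).trans (Nat.le_add_right _ _))
        (wordDeg_mul_le_of_le (hc k (by omega)) (ha j))
    have hck := (hrepr.mul_left (hc k (by omega))).mono
      (show D + K * s ≤ D + K * s + k * (K * s) + K * s by omega) le_rfl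
    refine ((ih'.add hck).congr ?_).mono (by ring_nf; omega) (by ring_nf; omega)
    rw [Finset.sum_range_succ, hline]
    simp only [add_mul, Finset.sum_add_distrib, mul_sub, Finset.mul_sum, mul_assoc]
    abel

/-- **Frege proofs give short two-sided representations.** For a sound rule list `F` there is `K` such
that an `F`-proof of `T` of size `≤ s` yields a representation of `tr T` by at most `K s³` single terms
`u · g · v` (`g` Boolean/commutator axioms) of cofactor degree `≤ K s² + K s`. [folklore] -/
theorem proofRepr (F : FregeSystem) (hF : F.IsSound) : ∃ K : ℕ, ∀ (n : ℕ) (π : List (PropForm ℕ))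
    (T : PropForm ℕ) (s : ℕ), F.IsProofOf π T → proofSize π ≤ s →
      Repr R (K * s ^ 2 + K * s) (K * s ^ 3) (trForm (stdLeaf R n) T) := by
  obtain ⟨K, hK⟩ := linesRepr (R := R) F hF
  refine ⟨K, fun n π T s hπ hs => ?_⟩
  have hL : π.length ≤ s := (length_le_proofSize π).trans hs
  have h := hK n π s hπ.1 (fun θ hθ => (size_le_proofSize hθ).trans hs) π.length le_rfl 0
    (fun j => if j = π.length - 1 then 1 else 0) (fun j _ => by split_ifs <;> simp)
  have hne : π ≠ [] := by
    rintro rfl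
    exact absurd hπ.2 (by simp)
  have hlen : 0 < π.length := List.length_pos_of_ne_nil hne
  have hlast : π.getD (π.length - 1) (PropForm.const true) = T := by
    rw [List.getD_eq_getElem?_getD, ← List.getLast?_eq_getElem?, hπ.2, Option.getD_some]
  have hmem : π.length - 1 ∈ Finset.range π.length := Finset.mem_range.2 (by omega)
  simp only [ite_mul, one_mul, zero_mul, Finset.sum_ite_eq', hmem, ↓reduceIte, hlast, zero_add] at h
  refine h.mono ?_ ?_
  · nlinarith [Nat.mul_le_mul_right (K * s) hL]
  · calc π.length * (K * s ^ 2) ≤ s * (K * s ^ 2) := Nat.mul_le_mul_right _ hL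
      _ = K * s ^ 3 := by ring

/-! ### The theorem -/

/-- Polynomial boundedness transported along the size bound of the tautologies `¬φ_n`: with
`P := p_F ∘ (5 p + 2)` (a polynomial), every unsatisfiable `φ_n` with `numClauses, size ≤ p(n)` has an
`F`-proof of `¬ ofCNF φ_n` of size `≤ P(n)`. [folklore] -/
theorem exists_proof_of_isPolyBounded {F : FregeSystem} (hpb : F.IsPolyBounded) (p : Polynomial ℕ) :
    ∃ P : Polynomial ℕ, ∀ (n : ℕ) (φ : CNF (Fin n)), ¬ φ.Satisfiable → φ.numClauses ≤ p.eval n →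
      φ.size ≤ p.eval n → ∃ π, F.IsProofOf π (PropForm.neg (PropForm.ofCNF (φ.map fun κ => κ.map fun l => (l.1.val, l.2)))) ∧
        proofSize π ≤ P.eval n := by
  obtain ⟨pF, hpF⟩ := hpb
  refine ⟨pF.comp (Polynomial.C 5 * p + Polynomial.C 2), fun n φ hφ hm hsz => ?_⟩
  obtain ⟨π, hπ, hπs⟩ := hpF _ (isTautology_neg_ofCNF hφ)
  refine ⟨π, hπ, hπs.trans ?_⟩
  rw [Polynomial.eval_comp]
  refine eval_mono_nat pF ?_
  have := size_ofCNF_le (φ.map fun κ => κ.map fun l => (l.1.val, l.2))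
  simp only [PropForm.size, size_map_val, numClauses_map_val, Polynomial.eval_add, Polynomial.eval_mul,
    Polynomial.eval_C] at this ⊢
  omega

end

end Summit.PneNP.PneNP.Theorems.CnfIdealGenLength

namespace Summit.PneNP.PneNP.Theorems

open Filter
open Literature.Computability.Complexity
open Literature.Computability.MetaComplexity
open Literature.Computability.MetaComplexity.NCIPS
open Summit.PneNP.PneNP.Theorems.CnfIdealGenLength

/-- **`FregeShortensGenLength` (item stmt-PneNP-18886), proved.** A polynomially bounded Frege system
forces polynomial two-sided generation length of the clause product of every polynomial-size family of
unsatisfiable CNFs: eventually `HasBoundedRepr ℚ (n^c) (n^c) (φ n)`. Proof: `¬ ofCNF (φ n)` is a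
tautology of size `≤ 5 p(n) + 2`, so it has an `F`-proof of size `s ≤ P(n)` (`P` polynomial); by
`proofRepr` (direct simulation of the proof inside `ℚ⟨x⟩` modulo the Boolean/commutator axioms, using
only the SOUNDNESS half of `IsFrege`) `tr(¬ ofCNF φ_n) = clauseProduct ℚ (φ n)` (`trForm_neg_ofCNF`) is a
sum of `≤ K s³` single terms of cofactor degree `≤ K s² + K s`; a polynomial in `n` is eventually
`≤ n^c` (`exists_pow_bound`), and padding gives exactly `n^c` terms. -/
theorem cnfIdealGenLength_fregeShortensGenLength_proof :
    Summit.PneNP.PneNP.Theses.CnfIdealGenLength.FregeShortensGenLength := by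
  intro F hF hpb p φ hφ
  obtain ⟨K, hK⟩ := proofRepr (R := ℚ) F hF.1
  obtain ⟨P, hP⟩ := exists_proof_of_isPolyBounded hpb p
  obtain ⟨e, -, he⟩ := exists_pow_bound (Polynomial.C K * P ^ 3 + Polynomial.C K * P ^ 2 + Polynomial.C K * P)
  refine ⟨e, ?_⟩
  filter_upwards [eventually_ge_atTop 2] with n hn
  obtain ⟨π, hπ, hs⟩ := hP n (φ n) (hφ n).1 (hφ n).2.1 (hφ n).2.2
  have h := hK n π _ (P.eval n) hπ hs
  rw [trForm_neg_ofCNF] at h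
  have hQ := he n hn
  simp only [Polynomial.eval_add, Polynomial.eval_mul, Polynomial.eval_C, Polynomial.eval_pow] at hQ
  exact hasBoundedRepr_of_repr (by omega) (h.mono (by omega) le_rfl) (by omega)

end Summit.PneNP.PneNP.Theorems
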